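import Summits.ValiantsHypothesis.ValiantsHypothesis.Theses.LiftNullstellensatz
import Summits.ValiantsHypothesis.ValiantsHypothesis.Theorems.DetQPDetqpSuperquadraticStubVertexGauge
import Summits.ValiantsHypothesis.ValiantsHypothesis.Theorems.DetQPDetqpSuperquadraticStubKrylovIdentities
import Literature.Computability.AlgebraicComplexity.VPDeterminantalQPProofs
import Literature.Computability.AlgebraicComplexity.WordLiftWidth
import Literature.Computability.AlgebraicComplexity.DeterminantalConormalBoundKernelAlgebra

/-!
# Route `LiftNullstellensatz` — support item `PerLiftQPOfVP` (stmt-ValiantsHypothesis-5923)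

The support item `PerLiftQPOfVP` of route `LiftNullstellensatz` (assembly glue, "known in print"):

  if `(per_n)_n` is a `VP` family over `ℂ` then there is `c` such that for EVERY `n` the permanent
  `per_n` has a word lift `Ψ : ([n]×[n])^n → ℂ` (a homogeneous noncommutative polynomial whose
  commutative image is `per_n`) all of whose sequential flattenings (Nisan's partial-coefficient
  matrices) have rank `≤ 2^((log₂ n + c)^c)` — a homogeneous algebraic branching program of
  quasi-polynomial width for the permanent.

## Proof (all ingredients are PROVED tree facts)

* `VP ⇒ dc quasi-polynomial`: `isQPBounded_determinantalComplexity_of_isVPFamily_holds`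
  (Bürgisser–Clausen–Shokrollahi 1997, Cor. (21.40): VSBR depth reduction + Valiant universality),
  and the infimum `dc(per_n)` is attained (`hasDetRepr_determinantalComplexity_holds`).
* `n ≥ 3`: every affine determinantal expression of `per_n` of size `w + 1` is regular (von zur
  Gathen 1987) and hence in Chatterjee–Kumar–Volk normal form `per_n = ρᵀ L^(n-2) γ` with
  homogeneous LINEAR `ρ, γ ∈ (S¹)^w`, `L ∈ M_w(S¹)` — recombined (`exists_krylov_perPoly`) from the
  tree theorems `DetQPDetqpSuperquadratic.stub_vertexGauge` / `stub_krylovIdentities` (route `DetQP`,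
  stubs S1a/S1b of crux `DetqpSuperquadratic`).
  Reading off the coefficient of each variable gives letter matrices, and the matrix product state
  `Ψ(x₀ x₁ ⋯ x_{n-1}) = e_{i₀}ᵀ B(x₀) Λ(x₁) ⋯ Λ(x_{n-2}) E(x_{n-1}) e_{i₀}` of bond dimension `w`
  (`B` carries `ρ` in row `i₀`, `E` carries `γ` in column `i₀`, `Λ(x) = [x]L`) is a word lift of
  `ρᵀ L^(n-2) γ` (`isWordLift_mps`, multilinear expansion of an ordered product of linear matrices,
  `prod_ofFn_sum_smul_map`); every flattening of a matrix product state factors through `ℂ^w`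
  (`rank_wordFlattening_mps_le`: `M_a(Ψ)[u,v] = (eᵀ B(u₀)⋯)(⋯E(v_{b-1}) e)` is a product of an
  `? × w` and a `w × ?` matrix), so all ranks are `≤ w < dc(per_n) ≤ 2^((log₂ n + c)^c)`.
  This is the easy direction of Nisan's width theorem (Nisan 1991, Thm. 1) for the uniform ABP.
* `n ≤ 2`: the naive lift `Ψ(w) = #{π ∈ 𝔖_n : w = ((π t, t))_t}` of `per_n = Σ_π Π_t X_{π t, t}`
  (`isWordLift_naive`); any flattening has rank `≤ #columns = (n²)^b ≤ 16`.
* Constants: with `c' = c + 2`, `2^((log₂ n + c)^c) ≤ 2^((log₂ n + c')^c')` and `16 ≤ 2^((log₂ n + c')^c')`.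

No new definitions: the matrix product state is written out as the explicit word tensor
`fun w => α ⬝ᵥ ((List.ofFn fun t => M t (w t)).prod *ᵥ ω)`; `IsWordLift` / `wordFlattening` are the
Literature notions of `WordLiftWidth.lean`, which unfold literally to the route's inline text.

References: Nisan 1991 (Thm. 1); Chatterjee–Kumar–Volk 2024 (Thm. 13, Cor. 14); von zur Gathen 1987;
Bürgisser–Clausen–Shokrollahi 1997 (Thm. (21.33), Cor. (21.40)); Valiant 1979.
-/

noncomputable section

-- `Summit.ValiantsHypothesis.ValiantsHypothesis.…` is the tree's mandated single-conjunct layout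
-- (Sub = Summit), so the duplicated namespace component is intended.
set_option linter.dupNamespace false

namespace Summit.ValiantsHypothesis.ValiantsHypothesis.Theorems.LiftNullstellensatzPerLiftQPOfVP

open MvPolynomial Matrix
open Literature.Computability.AlgebraicComplexity

/-! ### Matrix product states (uniform homogeneous ABPs) as word tensors -/

section MPS

variable {K : Type*} [Field K] {σ : Type*} [Fintype σ]

/-- Summing over words of length `N + 1` is summing over the first letter and the tail word
(`Fin.consEquiv`). [folklore] -/
theorem sum_pi_fin_succ {A : Type*} [AddCommMonoid A] {α : Type*} [Fintype α] {N : ℕ}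
    (F : (Fin (N + 1) → α) → A) :
    ∑ w, F w = ∑ x : α, ∑ w : Fin N → α, F (Fin.cons x w) := by
  rw [← Fintype.sum_prod_type']
  exact (Fintype.sum_equiv (Fin.consEquiv fun _ => α) _ _ fun _ => rfl).symm

/-- **Multilinear expansion of an ordered product of linear matrices.** For letter matrices
`M t : σ → K^{W × W}` (`t < N`), the ordered product of the matrices of linear forms
`Σ_x X_x · M t x` is the sum over all words `w ∈ σ^N` of the monomial `X_{w 0} ⋯ X_{w (N-1)}` times
the constant matrix `M 0 (w 0) ⋯ M (N-1) (w (N-1))` (the path expansion of a layered algebraic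
branching program; Nisan 1991, §2). [folklore] -/
theorem prod_ofFn_sum_smul_map {W N : ℕ} (M : Fin N → σ → Matrix (Fin W) (Fin W) K) :
    (List.ofFn fun t => ∑ x : σ, (X x : MvPolynomial σ K) • (M t x).map C).prod =
      ∑ w : Fin N → σ, (∏ t, (X (w t) : MvPolynomial σ K)) •
        ((List.ofFn fun t => M t (w t)).prod).map (C : K →+* MvPolynomial σ K) := by
  induction N with
  | zero => simp [Matrix.map_one]
  | succ N ih =>
    rw [List.ofFn_succ, List.prod_cons, ih (fun t => M t.succ), sum_pi_fin_succ, Finset.sum_mul]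
    refine Finset.sum_congr rfl fun x _ => ?_
    rw [Finset.mul_sum]
    refine Finset.sum_congr rfl fun w _ => ?_
    simp only [Fin.prod_univ_succ, Fin.cons_zero, Fin.cons_succ, List.ofFn_succ, List.prod_cons,
      Matrix.map_mul, smul_mul_assoc, mul_smul_comm, smul_smul]
    rw [mul_comm]

/-- **A matrix product state is a word lift of the polynomial it computes**: the word tensor
`Ψ(w) = αᵀ M₀(w₀) ⋯ M_{N-1}(w_{N-1}) ω` lifts `αᵀ (Π_t Σ_x X_x M_t(x)) ω` (a homogeneous ABP with
`N` layers of linear-form edges computes the noncommutative polynomial `Ψ`; Nisan 1991, §2).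
[folklore] -/
theorem isWordLift_mps {W N : ℕ} (α ω : Fin W → K) (M : Fin N → σ → Matrix (Fin W) (Fin W) K) :
    IsWordLift (fun w : Fin N → σ => α ⬝ᵥ ((List.ofFn fun t => M t (w t)).prod *ᵥ ω))
      ((fun i => C (α i)) ⬝ᵥ
        ((List.ofFn fun t => ∑ x : σ, (X x : MvPolynomial σ K) • (M t x).map C).prod *ᵥ
          fun i => C (ω i))) := by
  unfold IsWordLift
  rw [prod_ofFn_sum_smul_map, Matrix.sum_mulVec, dotProduct_sum]
  refine Finset.sum_congr rfl fun w _ => ?_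
  rw [Matrix.smul_mulVec, dotProduct_smul, MvPolynomial.smul_eq_C_mul, smul_eq_mul]
  rw [mul_comm]
  congr 1
  simp only [RingHom.map_dotProduct, RingHom.map_mulVec, Function.comp_def]

/-- **Every sequential flattening of a matrix product state of bond dimension `W` has rank `≤ W`**
(the easy half of Nisan 1991, Thm. 1): at the cut `a | b` the entry `Ψ(uv)` is the product of the
row vector `αᵀ M₀(u₀) ⋯ M_{a-1}(u_{a-1}) ∈ K^W` and the column vector `M_a(v₀) ⋯ M_{N-1}(v_{b-1}) ω ∈ K^W`,
so `M_a(Ψ)` factors through `K^W`. [cite: Nisan1991, Thm. 1] -/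
theorem rank_wordFlattening_mps_le {W N : ℕ} (α ω : Fin W → K)
    (M : Fin N → σ → Matrix (Fin W) (Fin W) K) (a b : ℕ) (h : a + b = N) :
    (wordFlattening (fun w : Fin N → σ => α ⬝ᵥ ((List.ofFn fun t => M t (w t)).prod *ᵥ ω))
      a b h).rank ≤ W := by
  classical
  subst h
  have hfac : wordFlattening
      (fun w : Fin (a + b) → σ => α ⬝ᵥ ((List.ofFn fun t => M t (w t)).prod *ᵥ ω)) a b rfl =
      (Matrix.of fun (u : Fin a → σ) (i : Fin W) =>
          (α ᵥ* (List.ofFn fun t : Fin a => M (Fin.castLE (Nat.le_add_right a b) t) (u t)).prod) i) *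
        Matrix.of fun (i : Fin W) (v : Fin b → σ) =>
          ((List.ofFn fun t : Fin b => M (Fin.natAdd a t) (v t)).prod *ᵥ ω) i := by
    ext u v
    rw [wordFlattening_apply, Matrix.mul_apply]
    simp only [Matrix.of_apply]
    rw [List.ofFn_add, List.prod_append, ← Matrix.mulVec_mulVec, Matrix.dotProduct_mulVec]
    simp only [Fin.cast_refl, id_eq, Fin.append_left', Fin.append_right]
    rfl
  rw [hfac]
  exact (Matrix.rank_mul_le_left _ _).trans
    ((Matrix.rank_le_card_width _).trans (Fintype.card_fin W).le)

/-! ### From a Krylov / Chatterjee–Kumar–Volk normal form to a matrix product state -/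

/-- Entries of the matrix of linear forms attached to letter matrices. [folklore] -/
theorem sum_smul_map_apply {W : ℕ} (B : σ → Matrix (Fin W) (Fin W) K) (i j : Fin W) :
    (∑ x, (X x : MvPolynomial σ K) • (B x).map C) i j = ∑ x, C (B x i j) * X x := by
  simp only [Matrix.sum_apply, Matrix.smul_apply, Matrix.map_apply, smul_eq_mul, mul_comm]

/-- A homogeneous linear form is recovered from its coefficients: `p = Σ_x (coeff e_x p) X_x`.
[folklore] -/
theorem sum_C_coeff_mul_X {p : MvPolynomial σ K} (hp : p.IsHomogeneous 1) :
    ∑ x, C (coeff (Finsupp.single x 1) p) * X x = p := by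
  have h0 : coeff 0 p = 0 := hp.coeff_eq_zero (by simp)
  conv_rhs => rw [DeterminantalConormal.eq_C_add_sum_of_totalDegree_le_one hp.totalDegree_le,
    h0, C_0, zero_add]

/-- **A Krylov normal form `ρᵀ L^m γ` with homogeneous linear `ρ, γ, L` of width `w ≥ 1` is
computed by a matrix product state of bond dimension `w` on words of length `m + 2`**, hence has a
word lift all of whose sequential flattenings have rank `≤ w` (Chatterjee–Kumar–Volk 2024, Thm. 13:
"`-bᵀ D^{d-2} c` is a homogeneous ABP of width `s - 1`", combined with Nisan 1991, Thm. 1).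
[cite: ChatterjeeKumarVolk2024, Thm. 13] -/
theorem exists_isWordLift_of_krylov {w m N : ℕ} (hN : m + 2 = N) (i₀ : Fin w)
    (ρ γ : Fin w → MvPolynomial σ K) (L : Matrix (Fin w) (Fin w) (MvPolynomial σ K))
    (hρ : ∀ i, (ρ i).IsHomogeneous 1) (hγ : ∀ i, (γ i).IsHomogeneous 1)
    (hL : ∀ i j, (L i j).IsHomogeneous 1) :
    ∃ Ψ : (Fin N → σ) → K, IsWordLift Ψ (ρ ⬝ᵥ ((L ^ m) *ᵥ γ)) ∧
      ∀ (a b : ℕ) (h : a + b = N), (wordFlattening Ψ a b h).rank ≤ w := by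
  classical
  subst hN
  -- letter matrices: `B` carries `ρ` in row `i₀`, `E` carries `γ` in column `i₀`, `Λ(x) = [x]L`
  set B : σ → Matrix (Fin w) (Fin w) K := fun x =>
    Matrix.of fun i j => if i = i₀ then coeff (Finsupp.single x 1) (ρ j) else 0 with hB
  set E : σ → Matrix (Fin w) (Fin w) K := fun x =>
    Matrix.of fun i j => if j = i₀ then coeff (Finsupp.single x 1) (γ i) else 0 with hE
  set Λ : σ → Matrix (Fin w) (Fin w) K := fun x =>
    L.map (coeff (Finsupp.single x 1)) with hΛ
  set M : Fin (m + 2) → σ → Matrix (Fin w) (Fin w) K := Fin.cons B (Fin.snoc (fun _ => Λ) E) with hM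
  refine ⟨fun w' => Pi.single i₀ 1 ⬝ᵥ ((List.ofFn fun t => M t (w' t)).prod *ᵥ Pi.single i₀ 1),
    ?_, fun a b h => rank_wordFlattening_mps_le _ _ M a b h⟩
  have key := isWordLift_mps (σ := σ) (Pi.single i₀ (1 : K)) (Pi.single i₀ 1) M
  -- the matrices of linear forms of the letter matrices
  set RB : Matrix (Fin w) (Fin w) (MvPolynomial σ K) :=
    Matrix.of fun i j => if i = i₀ then ρ j else 0 with hRB
  set RE : Matrix (Fin w) (Fin w) (MvPolynomial σ K) :=
    Matrix.of fun i j => if j = i₀ then γ i else 0 with hRE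
  have hlinB : (∑ x, (X x : MvPolynomial σ K) • (B x).map C) = RB := by
    refine Matrix.ext fun i j => ?_
    rw [sum_smul_map_apply]
    by_cases hi : i = i₀
    · simp only [hB, hRB, Matrix.of_apply, if_pos hi]
      exact sum_C_coeff_mul_X (hρ j)
    · simp [hB, hRB, hi]
  have hlinE : (∑ x, (X x : MvPolynomial σ K) • (E x).map C) = RE := by
    refine Matrix.ext fun i j => ?_
    rw [sum_smul_map_apply]
    by_cases hj : j = i₀
    · simp only [hE, hRE, Matrix.of_apply, if_pos hj]
      exact sum_C_coeff_mul_X (hγ i)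
    · simp [hE, hRE, hj]
  have hlinΛ : (∑ x, (X x : MvPolynomial σ K) • (Λ x).map C) = L := by
    refine Matrix.ext fun i j => ?_
    rw [sum_smul_map_apply]
    simp only [hΛ, Matrix.map_apply]
    exact sum_C_coeff_mul_X (hL i j)
  have hprod : (List.ofFn fun t : Fin (m + 2) =>
      ∑ x, (X x : MvPolynomial σ K) • (M t x).map C).prod = RB * (L ^ m * RE) := by
    rw [List.ofFn_succ, List.prod_cons, List.ofFn_succ_last, List.prod_append,
      List.prod_singleton]
    simp only [hM, Fin.cons_zero, Fin.cons_succ, Fin.snoc_castSucc, Fin.snoc_last, List.ofFn_const,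
      List.prod_replicate, hlinB, hlinE, hlinΛ]
  have he : (fun i => C ((Pi.single i₀ (1 : K) : Fin w → K) i)) =
      (Pi.single i₀ 1 : Fin w → MvPolynomial σ K) := by
    funext i
    by_cases hi : i = i₀
    · subst hi; simp
    · simp [hi]
  have hcol : RE.col i₀ = γ := by
    ext i; simp [hRE]
  have hval : (Pi.single i₀ 1 : Fin w → MvPolynomial σ K) ⬝ᵥ ((RB * (L ^ m * RE)) *ᵥ Pi.single i₀ 1)
      = ρ ⬝ᵥ ((L ^ m) *ᵥ γ) := by
    rw [← Matrix.mulVec_mulVec, ← Matrix.mulVec_mulVec, single_dotProduct, one_mul,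
      Matrix.mulVec_single_one, hcol, Matrix.mulVec, dotProduct, dotProduct]
    refine Finset.sum_congr rfl fun j _ => ?_
    simp [hRB]
  rw [he, hprod, hval] at key
  exact key

end MPS

/-! ### The naive lift of the permanent (used for `n ≤ 2`) -/

/-- **The naive word lift of the permanent**: `per_n = Σ_π Π_t X_{π t, t}` is lifted by the word
tensor counting the permutations `π` with `w = ((π t, t))_t`. [folklore] -/
theorem isWordLift_naive (n : ℕ) :
    IsWordLift (fun w : Fin n → Fin n × Fin n =>
        ∑ π : Equiv.Perm (Fin n), if w = (fun t => (π t, t)) then (1 : ℂ) else 0)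
      (perPoly (Fin n) ℂ) := by
  classical
  unfold IsWordLift
  simp only [Finset.sum_smul, ite_smul, one_smul, zero_smul]
  rw [Finset.sum_comm]
  simp only [Finset.sum_ite_eq', Finset.mem_univ, if_true]
  simp [perPoly, Matrix.permanent, Matrix.mvPolynomialX]

/-! ### The item -/

/-- Arithmetic of the constants: enlarging `c` to `c + 2` dominates both the determinantal bound
`2^((log₂ n + c)^c)` and the constant `16` of the small cases. [folklore] -/
theorem two_pow_mono (L c : ℕ) :
    2 ^ ((L + c) ^ c) ≤ 2 ^ ((L + (c + 2)) ^ (c + 2)) ∧ 16 ≤ 2 ^ ((L + (c + 2)) ^ (c + 2)) := by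
  constructor
  · refine Nat.pow_le_pow_right (by norm_num) ?_
    calc (L + c) ^ c ≤ (L + (c + 2)) ^ c := Nat.pow_le_pow_left (by omega) c
      _ ≤ (L + (c + 2)) ^ (c + 2) := Nat.pow_le_pow_right (by omega) (by omega)
  · have h4 : 4 ≤ (L + (c + 2)) ^ (c + 2) :=
      calc 4 = 2 ^ 2 := by norm_num
        _ ≤ 2 ^ (c + 2) := Nat.pow_le_pow_right (by norm_num) (by omega)
        _ ≤ (L + (c + 2)) ^ (c + 2) := Nat.pow_le_pow_left (by omega) _
    calc (16 : ℕ) = 2 ^ 4 := by norm_num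
      _ ≤ 2 ^ ((L + (c + 2)) ^ (c + 2)) := Nat.pow_le_pow_right (by norm_num) h4

/-- **Krylov normal form of the permanent** (Chatterjee–Kumar–Volk 2024, Thm. 13 for the
permanent via von zur Gathen regularity; the tree's stubs S1a `stub_vertexGauge` and S1b
`stub_krylovIdentities` of route `DetQP`, recombined): every affine determinantal expression of
`per_n` (`n ≥ 3`) of size `w + 1` gives homogeneous linear `ρ, γ ∈ (S¹)^w`, `L ∈ M_w(S¹)` with
`ρᵀ L^(n-2) γ = per_n`. [cite: ChatterjeeKumarVolk2024, Thm. 13] -/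
theorem exists_krylov_perPoly {n w : ℕ} (hn : 3 ≤ n) (h : HasDetRepr (perPoly (Fin n) ℂ) (w + 1)) :
    ∃ (ρ γ : Fin w → MvPolynomial (Fin n × Fin n) ℂ)
      (L : Matrix (Fin w) (Fin w) (MvPolynomial (Fin n × Fin n) ℂ)),
      (∀ i, (ρ i).IsHomogeneous 1) ∧ (∀ i, (γ i).IsHomogeneous 1) ∧
      (∀ i j, (L i j).IsHomogeneous 1) ∧ ρ ⬝ᵥ ((L ^ (n - 2)) *ᵥ γ) = perPoly (Fin n) ℂ := by
  have hhom : (perPoly (Fin n) ℂ).IsHomogeneous n := by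
    simpa [Fintype.card_fin] using (perPoly_isHomogeneous (n := Fin n) (k := ℂ))
  obtain ⟨ρ, γ, L, hρ, hγ, hL, hadj⟩ := DetQPDetqpSuperquadratic.stub_vertexGauge n hn w h
  obtain ⟨hA3, -, -⟩ := DetQPDetqpSuperquadratic.stub_krylovIdentities ℂ (Fin n × Fin n) n w
    (perPoly (Fin n) ℂ) ρ γ L (by omega) hhom hρ hγ hL hadj
  refine ⟨ρ, γ, -L, hρ, hγ, fun i j => ?_, hA3⟩
  rw [Matrix.neg_apply]
  exact (hL i j).neg

/-- **Item `PerLiftQPOfVP` (stmt-ValiantsHypothesis-5923) of route `LiftNullstellensatz`.**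
If the permanent family is a `VP` family over `ℂ`, then for some `c` and every `n` the permanent
`per_n` has a word lift all of whose sequential flattenings have rank `≤ 2^((log₂ n + c)^c)`
(a homogeneous ABP of quasi-polynomial width): `VP ⇒ dc(per_n) ≤ 2^{polylog}`
(Bürgisser–Clausen–Shokrollahi 1997, Cor. (21.40), proved in tree), the attained determinantal
expression is regular (von zur Gathen 1987) hence a single-matrix homogeneous ABP
`per_n = ρᵀ L^(n-2) γ` of width `dc(per_n) - 1` (Chatterjee–Kumar–Volk 2024, Thm. 13, proved in
tree for the permanent), whose word tensor has all flattening ranks `≤ dc(per_n) - 1`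
(Nisan 1991); `n ≤ 2` by the naive lift. -/
theorem perLiftQPOfVP_proof :
    Summit.ValiantsHypothesis.ValiantsHypothesis.Theses.LiftNullstellensatz.PerLiftQPOfVP := by
  intro hVP
  obtain ⟨c, hc⟩ := isQPBounded_determinantalComplexity_of_isVPFamily_holds _ hVP
  refine ⟨c + 2, fun n => ?_⟩
  obtain ⟨hmono, h16⟩ := two_pow_mono (Nat.log 2 n) c
  rcases lt_or_ge n 3 with hn | hn
  · -- small `n`: the naive lift, rank ≤ number of columns ≤ 16
    refine ⟨_, isWordLift_naive n, fun a b h => ?_⟩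
    refine (Matrix.rank_le_card_width _).trans ?_
    rw [Fintype.card_fun, Fintype.card_prod, Fintype.card_fin, Fintype.card_fin]
    have hn2 : n ≤ 2 := by omega
    have hnn : n * n ≤ 4 := (Nat.mul_le_mul hn2 hn2).trans (by norm_num)
    calc (n * n) ^ b ≤ 4 ^ b := Nat.pow_le_pow_left hnn b
      _ ≤ 4 ^ 2 := Nat.pow_le_pow_right (by norm_num) (by omega)
      _ = 16 := by norm_num
      _ ≤ _ := h16
  · -- `n ≥ 3`: Krylov normal form of the attained determinantal expression
    have hdc := hc n
    have hdeg : (perPoly (Fin n) ℂ).totalDegree ≤ determinantalComplexity (perPoly (Fin n) ℂ) :=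
      totalDegree_le_determinantalComplexity_holds _
    have htd : (perPoly (Fin n) ℂ).totalDegree = Fintype.card (Fin n) := totalDegree_perPoly_holds
    rw [Fintype.card_fin] at htd
    obtain ⟨w, hw⟩ : ∃ w : ℕ, determinantalComplexity (perPoly (Fin n) ℂ) = w + 1 :=
      ⟨determinantalComplexity (perPoly (Fin n) ℂ) - 1, by omega⟩
    have hrep : HasDetRepr (perPoly (Fin n) ℂ) (w + 1) :=
      hw ▸ hasDetRepr_determinantalComplexity_holds _
    obtain ⟨ρ, γ, L, hρ, hγ, hL, hper⟩ := exists_krylov_perPoly hn hrep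
    have hw1 : 1 ≤ w := by omega
    obtain ⟨Ψ, hΨ, hrank⟩ := exists_isWordLift_of_krylov (K := ℂ) (σ := Fin n × Fin n)
      (m := n - 2) (N := n) (by omega) ⟨0, hw1⟩ ρ γ L hρ hγ hL
    rw [hper] at hΨ
    refine ⟨Ψ, hΨ, fun a b h => (hrank a b h).trans ?_⟩
    calc w ≤ w + 1 := Nat.le_succ w
      _ = determinantalComplexity (perPoly (Fin n) ℂ) := hw.symm
      _ ≤ 2 ^ ((Nat.log 2 n + c) ^ c) := hdc
      _ ≤ _ := hmono

end Summit.ValiantsHypothesis.ValiantsHypothesis.Theorems.LiftNullstellensatzPerLiftQPOfVP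

end
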